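import Summits.QuantumFields.YangMills.Theses.SmallCircleAnchor

/-!
# `SmallCircleAnchor.Assembly` — the assembly item of route `SmallCircleAnchor`

Route `SmallCircleAnchor` (sub-problem `YangMills` of summit `QuantumFields`) files, as its assembly
item `Assembly` (stmt-QuantumFields-9658), the implication chain

`AnchorGap → AdiabaticContinuity → EndpointTransfer → ContinuumLegGivenGap → YangMills`.

This is *verbatim* the type of the route's deciding theorem
`Summit.QuantumFields.YangMills.Theses.SmallCircleAnchor.closes` (planner-authored, sorry-free,
kernel-checked with the route file). Its content is pure bookkeeping: fix `G` compact simple and a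
faithful unitary lattice representation `r`; `AnchorGap` supplies the abelianising deformation `V`;
`AdiabaticContinuity` at temporal extent `T = 1` supplies the threshold `ε₁`; `AnchorGap` at
`(T = 1, threshold max ε₁ 0)` supplies the schedule `E` and `β₀` with the anchor clustering bound;
`AdiabaticContinuity` returns `β₁` and, for each `β ≥ β₁`, one rate `m` with Leg B; Leg B at `s = 0`
(admissible since `0 ≤ 0 ≤ max ε₁ 0 ≤ E β`) is, after `simp only [zero_mul, sub_zero]`, the
hypothesis of `EndpointTransfer`, which yields the volume-uniform weak-coupling lattice gap for `r`;
as this holds for every `r`, `ContinuumLegGivenGap` returns the `∃ r sch T …` body of `YangMills`.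
This file closes the item by that definitional unfolding; it adds no mathematics of its own.

Sources: route-internal (the deciding theorem `closes`); Jaffe–Witten 2000 for the clauses packaged
in `YangMills`; Ünsal–Yaffe (arXiv:0803.0344) for the physical picture the cruxes describe.
Deliberately NOT here: any of the cruxes (`AnchorGap`, `AdiabaticContinuity`,
`ContinuumLegGivenGap`), the target `UniformLatticeGap`, or the supports (`EndpointTransfer`,
`OneLayerAnchor`, `PolyakovAnchorClustering`) — they stay open items of the route.
-/

namespace Summit.QuantumFields.YangMills.Theorems

/-- **`SmallCircleAnchor.Assembly` holds** (assembly item stmt-QuantumFields-9658): the chain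
`AnchorGap → AdiabaticContinuity → EndpointTransfer → ContinuumLegGivenGap → YangMills`.
Proof: after unfolding, the goal is literally the type of the route's sorry-free deciding theorem
`SmallCircleAnchor.closes` (anchor at `T = 1` with threshold `max ε₁ 0`, Leg B at `s = 0`).
[folklore] -/
theorem smallCircleAnchor_assembly_proof :
    Summit.QuantumFields.YangMills.Theses.SmallCircleAnchor.Assembly := by
  unfold Summit.QuantumFields.YangMills.Theses.SmallCircleAnchor.Assembly
  exact Summit.QuantumFields.YangMills.Theses.SmallCircleAnchor.closes

end Summit.QuantumFields.YangMills.Theorems
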